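import Summits.HubbardSuperconductivity.HubbardSuperconductivity.Theorems.AnisotropyChordTransferFibre3FinXDCheck

/-!
# Route `AnisotropyChord` / H0 rotor rung: FIN per-`L` row-D (KT-2a″) SUB-CELL facts, `L = 10` (30–35)

Row-D facts `xdCellAny0 10 (49/50) la lb aD = true` on quarter sub-cells of the combined cells whose side condition needs `aD ≈ .04` (mechhunt STATUS p3 g7 REPORT 3).
Prover seat `hubbard-h0-rotor-p3` g7; helper for piece A = stmt-HubbardSuperconductivity-23918 of rung 19089 (`--supports`, helper class).
WHAT THIS IS NOT: nothing here proves superconductivity in the Hubbard model (rotor TARGET as worded stays FALSE, g15 verdict); kernel facts /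
assembly for ONE conditional reduction at one `L`.  No sorry.
-/

set_option linter.dupNamespace false
set_option autoImplicit false

namespace Summit.HubbardSuperconductivity.HubbardSuperconductivity.Theorems.AnisotropyChord.Transfer.Fibre3

namespace FinXD

/-- row-D sub-cell `[16698939187447843, 16802019058975299]` of `L = 10`. [folklore] -/
theorem xd10s_136_2 : xdCellAny0 10 (49/50 : ℚ) 16698939187447843 16802019058975299 (1/25 : ℚ) = true := by decide +kernel

/-- row-D sub-cell `[16802019058975299, 16905098930502755]` of `L = 10`. [folklore] -/
theorem xd10s_136_3 : xdCellAny0 10 (49/50 : ℚ) 16802019058975299 16905098930502755 (1/25 : ℚ) = true := by decide +kernel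

/-- row-D sub-cell `[16905098930502755, 17010755798818397]` of `L = 10`. [folklore] -/
theorem xd10s_137_0 : xdCellAny0 10 (49/50 : ℚ) 16905098930502755 17010755798818397 (1/25 : ℚ) = true := by decide +kernel

/-- row-D sub-cell `[17010755798818397, 17116412667134040]` of `L = 10`. [folklore] -/
theorem xd10s_137_1 : xdCellAny0 10 (49/50 : ℚ) 17010755798818397 17116412667134040 (1/25 : ℚ) = true := by decide +kernel

/-- row-D sub-cell `[17116412667134040, 17222069535449682]` of `L = 10`. [folklore] -/
theorem xd10s_137_2 : xdCellAny0 10 (49/50 : ℚ) 17116412667134040 17222069535449682 (1/25 : ℚ) = true := by decide +kernel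

/-- row-D sub-cell `[17222069535449682, 17327726403765325]` of `L = 10`. [folklore] -/
theorem xd10s_137_3 : xdCellAny0 10 (49/50 : ℚ) 17222069535449682 17327726403765325 (1/25 : ℚ) = true := by decide +kernel

end FinXD

end Summit.HubbardSuperconductivity.HubbardSuperconductivity.Theorems.AnisotropyChord.Transfer.Fibre3
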